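import Summits.QuantumFields.BalabanUV.T4Continuum.Support.SubstrateComplexBlockAvg

/-!
# SUBSTRATE — W-24c-α = LIBRARY L-E18b PART 2α, module 1∕2 (typer (π3), `HOME/CLAIMS.log` l.23334): THE INVERSE SIDE OF THE COMPLEX (0.4)
# STEP WITHOUT INVERSION — the REVERSED axial word and `eml` of the REVERSED loop variables on two-sided data `(R, S)` —, its REAL TIE
# `avgSR (ι∘U) (ι∘U⁻¹) c = ι (M U c)⁻¹` on small fields, its HOLOMORPHY, and the INVERSE INVARIANT `avgSR · avgRS = 1 = avgRS · avgSR`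
# inside the `1∕3` window (the hypothesis the next level of the tower consumes)

Cell `pub-balaban`, SUBSTRATE cell, seat `b2b-balaban-substrate-p1` (gen 7).  Numbered by the substrate typer (π3) (`HOME/CLAIMS.log` l.23334; OFFER
l.23182, STAGED l.23292): W-24c = L-E18b PART 2 is split into 2α (this pair of modules: the two-sided TOWER and its chart coordinate at the real point,
p1 g7), 2β (`SubstrateComplexAvgTowerDisc`: the depth disc, p4 g5) and PART 3 = W-24d (the `FineFieldChart` inhabitant, p2 g6).  Summits-side under the
LEAN PLACEMENT RULE; [folklore] algebra over W-24b PART 1 (p2 g6 `SubstrateComplexBlockAvg` p240835: `holRS`, `loopHolRS`, `axialRS`, `corrRS`, `avgRS`,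
`holRS_hom_eq`, `corrRS_hom_eq_of_small`, `avgRS_hom_eq_of_small`, `analyticAt_holRS`, `analyticAt_avgRS`, `sliceR`∕`sliceS`, `sliceR_mul_sliceS`,
`fundamentalRep_expMeanLogSU_E`), W-24a (p4 g5 `SubstrateExpChartLog` p240014: `logChartT`, `logChartT_self_of_unitary`, `expChartT_logChartT_of_unitary`,
`analyticAt_logChartT_comp`, `norm_centre_window_lt_one`), the tree's (0.4) vocabulary (`BlockAveraging.loopHol ∕ corr ∕ blockAvg ∕ Small`,
`T4Continuum.walk ∕ walkEnd ∕ wordRev ∕ holAt_walk_wordRev`, `ExpMeanLog.eml ∕ eml_inv_mul ∕ eml_mul_inv ∕ analyticAt_eml`) and p220490's `towerDataOf` ∕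
`expChart(Inv)` BY NAME; nothing restated, nothing printed asserted, no citation tags, no `Prop`-valued fact minted.

HONEST FRAMING: rung (B)+1 of the FINITE-VOLUME T⁴ programme — NOT infinite volume, NOT a mass gap, NOT Clay; spine PROVED 0∕9; a
CONSTRUCTION (the complexification of the averaging TOWER of record) + its analyticity at the real point BY NAME — NO estimate of any NE row;
nothing of [Balaban1985Averaging] ∕ [Balaban1987RG1] (0.4)–(0.9) asserted beyond what `BlockAveraging*` PROVES; NE5 NOT PRINTED ∕ NOT PROVED.
NOT IN W-24c-α: the depth disc (letter (3) of `FineFieldChart` and holomorphy on the WHOLE unit disc — a continuity estimate keeping every level's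
loop variables in the window: W-24c-β), the real tie for real `z ≠ 0` (letter (4)), the reach (5), and the `FineFieldChart` inhabitant (W-24d); the
`1∕3`-smallness at `z ≠ 0` and the log window at `z ≠ 0` are DISPLAYED letters here.  HONEST DEPENDENCY (cell line, verbatim): continuum YM on T⁴ ⇐
BetaPertH ∧ nine spine estimates (0/9 proved); BetaPertH ⇐ (D1) ∧ (D4) ∧ CAP+tail; G-an2-4 gates asym, D1 and NE2/3/4.

WHAT (§1).  `holRS_walk_wordRev_mul` ∕ `mul_holRS_walk_wordRev` (two-sided data that are bondwise mutual inverses have mutually inverse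
holonomies along `w` and `−w` — the two-sided twin of `T4Continuum.holAt_walk_wordRev`, stated multiplicatively); `axialWord`, `loopW`
(`axialRS_eq` ∕ `loopHolRS_eq` rfl); **`axialSR`**, **`loopHolSR`** (reversed words read from their ends), **`corrSR := eml ∘ loopHolSR`**,
**`avgSR := axialSR * corrSR`**; real ties `axialSR_hom_eq` (`= ι (axialAvg U c)⁻¹`), `loopHolSR_hom_eq` (`= ι (loopHol U c i)⁻¹`),
**`corrSR_hom_eq_of_small`** (`= ι (corr ℰ U c)⁻¹`; `eml_inv_mul` BY NAME, needs `ℰ.δ ≤ 1∕3` and `‖ι g − 1‖ = dist1 g`), **`avgSR_hom_eq_of_small`**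
(`= ι ((blockAvg ℰ).avg U c)⁻¹`); pairings `loopHolSR_mul_loopHolRS` ∕ `loopHolRS_mul_loopHolSR` ∕ `axialSR_mul_axialRS` ∕ `axialRS_mul_axialSR`; the
invariants **`avgSR_mul_avgRS`** ∕ **`avgRS_mul_avgSR`** (`= 1` for bondwise mutually inverse data with `1∕3`-small loop variables); **`analyticAt_avgSR`**.
0 sorry; axioms ⊆ {propext, Classical.choice, Quot.sound}.
-/

noncomputable section

open scoped Matrix.Norms.L2Operator BigOperators

namespace Summit.QuantumFields.BalabanUV.T4Continuum.SubstrateComplexBlockAvgInv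

open Literature.MathematicalPhysics.QuantumFieldTheory.Balaban1983to89
open Literature.MathematicalPhysics.QuantumFieldTheory.Balaban1983to89.T4Continuum (Letter LStep holAt walk walkEnd wordRev loopWord
  axialAvg_eq_holAt_walk holAt_walk_wordRev)
open Literature.MathematicalPhysics.QuantumFieldTheory.Balaban1983to89.BlockAveraging (Idx off loopHol corr avgFun blockAvg Small)
open Literature.MathematicalPhysics.QuantumFieldTheory.Balaban1983to89.ExpMeanLog (eml analyticAt_eml eml_inv_mul eml_mul_inv expMeanLogSU)
open Literature.MathematicalPhysics.QuantumFieldTheory.Balaban1983to89.B5Prop11Plancherel (Tor fine)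
open Literature.MathematicalPhysics.QuantumFieldTheory.Balaban1983to89.B5G183RateUnitTower (lev)
open Literature.MathematicalPhysics.QuantumLattice (fundamentalRep fundamentalRep_mem_unitaryGroup)
open Summit.QuantumFields.BalabanUV.T4Continuum.SubstrateBackgroundTransporters (transV siteIdx unitMod)
open Summit.QuantumFields.BalabanUV.T4Continuum.SubstrateTransporterSpecies (TowerData towerDataOf isUnit_det_of_mem_unitaryGroup)
open Summit.QuantumFields.BalabanUV.T4Continuum.SubstrateTransporterSpeciesHolo (expChartT expChartInvT)
open Summit.QuantumFields.BalabanUV.T4Continuum.SubstrateExpChartLog (logChartT logChartT_self_of_unitary analyticAt_logChartT_comp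
  norm_centre_window_lt_one isUnit_det_of_unitary)
open Summit.QuantumFields.BalabanUV.T4Continuum.SubstrateComplexBlockAvg

variable {P : Params} {j : ℕ}

/-! ## §1 The inverse side of the complex (0.4) step — reversed words, no inversion -/

section Monoid

variable {𝔸 : Type*} [Monoid 𝔸]

/-- [folklore] **MUTUALLY INVERSE TWO-SIDED DATA HAVE MUTUALLY INVERSE HOLONOMIES ALONG `w` AND `−w`**, I (the two-sided twin of
`T4Continuum.holAt_walk_wordRev`, stated multiplicatively — no inverse is ever taken): `holRS R S (−w from the end) · holRS R S w = 1`. -/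
theorem holRS_walk_wordRev_mul {R S : PBond P j → 𝔸} (hSR : ∀ b, S b * R b = 1) (hRS : ∀ b, R b * S b = 1) :
    ∀ (x : Site P j) (w : List (Letter P.d)), holRS R S (walk (walkEnd x w) (wordRev w)) * holRS R S (walk x w) = 1
  | x, [] => by simp only [T4Continuum.wordRev_nil, walk, walkEnd, holRS_nil, mul_one]
  | x, (μ, true) :: w => by
    have h1 : wordRev ((μ, true) :: w) = wordRev w ++ [(μ, false)] := by rw [T4Continuum.wordRev_cons]; rfl
    rw [h1]
    simp only [walkEnd, walk]
    rw [T4Continuum.walk_append, holRS_append, T4Continuum.walkEnd_walkEnd_wordRev]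
    simp only [walk, holRS_cons, holRS_nil, Site.unshift_shift, Bool.false_eq_true, ↓reduceIte, mul_one]
    rw [mul_assoc, ← mul_assoc (S ⟨x, μ⟩), hSR, one_mul, holRS_walk_wordRev_mul hSR hRS (x.shift μ) w]
  | x, (μ, false) :: w => by
    have h1 : wordRev ((μ, false) :: w) = wordRev w ++ [(μ, true)] := by rw [T4Continuum.wordRev_cons]; rfl
    rw [h1]
    simp only [walkEnd, walk]
    rw [T4Continuum.walk_append, holRS_append, T4Continuum.walkEnd_walkEnd_wordRev]
    simp only [walk, holRS_cons, holRS_nil, Bool.false_eq_true, ↓reduceIte, mul_one]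
    rw [mul_assoc, ← mul_assoc (R ⟨x.unshift μ, μ⟩), hRS, one_mul, holRS_walk_wordRev_mul hSR hRS (x.unshift μ) w]

/-- [folklore] **… II**: `holRS R S w · holRS R S (−w from the end) = 1`. -/
theorem mul_holRS_walk_wordRev {R S : PBond P j → 𝔸} (hSR : ∀ b, S b * R b = 1) (hRS : ∀ b, R b * S b = 1) :
    ∀ (x : Site P j) (w : List (Letter P.d)), holRS R S (walk x w) * holRS R S (walk (walkEnd x w) (wordRev w)) = 1
  | x, [] => by simp only [T4Continuum.wordRev_nil, walk, walkEnd, holRS_nil, mul_one]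
  | x, (μ, true) :: w => by
    have h1 : wordRev ((μ, true) :: w) = wordRev w ++ [(μ, false)] := by rw [T4Continuum.wordRev_cons]; rfl
    rw [h1]
    simp only [walkEnd, walk]
    rw [T4Continuum.walk_append, holRS_append, T4Continuum.walkEnd_walkEnd_wordRev]
    simp only [walk, holRS_cons, holRS_nil, Site.unshift_shift, Bool.false_eq_true, ↓reduceIte, mul_one]
    rw [mul_assoc, ← mul_assoc (holRS R S (walk (x.shift μ) w)), mul_holRS_walk_wordRev hSR hRS (x.shift μ) w, one_mul, hRS]
  | x, (μ, false) :: w => by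
    have h1 : wordRev ((μ, false) :: w) = wordRev w ++ [(μ, true)] := by rw [T4Continuum.wordRev_cons]; rfl
    rw [h1]
    simp only [walkEnd, walk]
    rw [T4Continuum.walk_append, holRS_append, T4Continuum.walkEnd_walkEnd_wordRev]
    simp only [walk, holRS_cons, holRS_nil, Bool.false_eq_true, ↓reduceIte, mul_one]
    rw [mul_assoc, ← mul_assoc (holRS R S (walk (x.unshift μ) w)), mul_holRS_walk_wordRev hSR hRS (x.unshift μ) w, one_mul, hSR]

/-- [folklore] The axial word of the coarse bond `c`: `L` steps `+e_{c.dir}` (the word of `axialRS` ∕ `AveragingRT.axialAvg`). -/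
def axialWord (c : PBond P (j + 1)) : List (Letter P.d) := List.replicate P.L (c.dir, true)

/-- [folklore] The (0.4) loop word at `c` with index `i` (the word of `loopHolRS` ∕ `BlockAveraging.loopHol`). -/
def loopW (c : PBond P (j + 1)) (i : Idx P) : List (Letter P.d) := loopWord P.L c.dir (off i.1) i.2.1 i.2.2

/-- [folklore] `axialRS` reads the axial word (`rfl`). -/
theorem axialRS_eq (R S : PBond P j → 𝔸) (c : PBond P (j + 1)) : axialRS R S c = holRS R S (walk (emb c.src) (axialWord c)) := rfl

/-- [folklore] `loopHolRS` reads the loop word (`rfl`). -/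
theorem loopHolRS_eq (R S : PBond P j → 𝔸) (c : PBond P (j + 1)) (i : Idx P) :
    loopHolRS R S c i = holRS R S (walk (emb c.src) (loopW c i)) := rfl

/-- [folklore] **THE INVERSE-SIDE AXIAL FACTOR**: the REVERSED axial word read from its end (on real data: `ι (axialAvg U c)⁻¹`). -/
def axialSR (R S : PBond P j → 𝔸) (c : PBond P (j + 1)) : 𝔸 :=
  holRS R S (walk (walkEnd (emb c.src) (axialWord c)) (wordRev (axialWord c)))

/-- [folklore] **THE INVERSE-SIDE LOOP VARIABLES**: the REVERSED (0.4) loop words read from their ends (= their starts: the words are closed). -/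
def loopHolSR (R S : PBond P j → 𝔸) (c : PBond P (j + 1)) (i : Idx P) : 𝔸 :=
  holRS R S (walk (walkEnd (emb c.src) (loopW c i)) (wordRev (loopW c i)))

/-- [folklore] Real tie of the inverse-side axial factor: `axialSR (ι∘U) (ι∘U⁻¹) c = ι (axialAvg U c)⁻¹` (`holAt_walk_wordRev`). -/
theorem axialSR_hom_eq {G : Type*} [GaugeGroup G] (ι : G →* 𝔸) (U : GaugeField P j G) (c : PBond P (j + 1)) :
    axialSR (fun b => ι (U b)) (fun b => ι (U b)⁻¹) c = ι (AveragingRT.axialAvg U c)⁻¹ := by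
  rw [axialSR, holRS_hom_eq, holAt_walk_wordRev, axialAvg_eq_holAt_walk]; rfl

/-- [folklore] Real tie of the inverse-side loop variables: `loopHolSR (ι∘U) (ι∘U⁻¹) c i = ι (loopHol U c i)⁻¹`. -/
theorem loopHolSR_hom_eq {G : Type*} [GaugeGroup G] (ι : G →* 𝔸) (U : GaugeField P j G) (c : PBond P (j + 1)) (i : Idx P) :
    loopHolSR (fun b => ι (U b)) (fun b => ι (U b)⁻¹) c i = ι (loopHol U c i)⁻¹ := by
  rw [loopHolSR, holRS_hom_eq, holAt_walk_wordRev]; rfl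

/-- [folklore] For bondwise mutually inverse data the inverse-side loop variables ARE two-sided inverses of the loop variables. -/
theorem loopHolSR_mul_loopHolRS {R S : PBond P j → 𝔸} (hSR : ∀ b, S b * R b = 1) (hRS : ∀ b, R b * S b = 1)
    (c : PBond P (j + 1)) (i : Idx P) : loopHolSR R S c i * loopHolRS R S c i = 1 :=
  holRS_walk_wordRev_mul hSR hRS _ _

/-- [folklore] … and in the other order. -/
theorem loopHolRS_mul_loopHolSR {R S : PBond P j → 𝔸} (hSR : ∀ b, S b * R b = 1) (hRS : ∀ b, R b * S b = 1)
    (c : PBond P (j + 1)) (i : Idx P) : loopHolRS R S c i * loopHolSR R S c i = 1 :=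
  mul_holRS_walk_wordRev hSR hRS _ _

/-- [folklore] Likewise for the axial factors. -/
theorem axialSR_mul_axialRS {R S : PBond P j → 𝔸} (hSR : ∀ b, S b * R b = 1) (hRS : ∀ b, R b * S b = 1)
    (c : PBond P (j + 1)) : axialSR R S c * axialRS R S c = 1 :=
  holRS_walk_wordRev_mul hSR hRS _ _

/-- [folklore] … and in the other order. -/
theorem axialRS_mul_axialSR {R S : PBond P j → 𝔸} (hSR : ∀ b, S b * R b = 1) (hRS : ∀ b, R b * S b = 1)
    (c : PBond P (j + 1)) : axialRS R S c * axialSR R S c = 1 :=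
  mul_holRS_walk_wordRev hSR hRS _ _

end Monoid

section Step

variable {𝔸 : Type*} [NormedRing 𝔸] [NormedAlgebra ℂ 𝔸]

/-- [folklore] **THE INVERSE-SIDE CORRECTION FACTOR**: `eml` of the REVERSED loop variables (no guard; used inside the window). -/
def corrSR (R S : PBond P j → 𝔸) (c : PBond P (j + 1)) : 𝔸 := eml (loopHolSR R S c)

/-- [folklore] **THE INVERSE SIDE OF THE COMPLEX (0.4) STEP**: reversed axial word × `eml` of the reversed loop words — the order that
makes it the two-sided inverse of `avgRS = corrRS * axialRS`. -/
def avgSR (R S : PBond P j → 𝔸) (c : PBond P (j + 1)) : 𝔸 := axialSR R S c * corrSR R S c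

variable [CompleteSpace 𝔸]

/-- [folklore] **THE INVERSE INVARIANT, I**: for bondwise mutually inverse data whose loop variables at `c` are `1∕3`-small,
`avgSR R S c * avgRS R S c = 1` (`ExpMeanLog.eml_inv_mul` on the pairs `loopHolRS i · loopHolSR i = 1`, then the axial factors). -/
theorem avgSR_mul_avgRS {R S : PBond P j → 𝔸} (hSR : ∀ b, S b * R b = 1) (hRS : ∀ b, R b * S b = 1) {c : PBond P (j + 1)}
    (hsmall : ∀ i, ‖loopHolRS R S c i - 1‖ ≤ 1 / 3) : avgSR R S c * avgRS R S c = 1 := by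
  rw [avgSR, avgRS, corrSR, corrRS, mul_assoc, ← mul_assoc (eml (loopHolSR R S c)),
    eml_inv_mul (loopHolRS_mul_loopHolSR hSR hRS c) hsmall, one_mul, axialSR_mul_axialRS hSR hRS]

/-- [folklore] **THE INVERSE INVARIANT, II**: `avgRS R S c * avgSR R S c = 1` under the same hypotheses — so INSIDE THE WINDOW the complex
step maps two-sided inverse pairs to two-sided inverse pairs (the hypothesis the next level's instance of I∕II consumes). -/
theorem avgRS_mul_avgSR {R S : PBond P j → 𝔸} (hSR : ∀ b, S b * R b = 1) (hRS : ∀ b, R b * S b = 1) {c : PBond P (j + 1)}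
    (hsmall : ∀ i, ‖loopHolRS R S c i - 1‖ ≤ 1 / 3) : avgRS R S c * avgSR R S c = 1 := by
  rw [avgSR, avgRS, corrSR, corrRS, mul_assoc, ← mul_assoc (axialRS R S c), axialRS_mul_axialSR hSR hRS,
    one_mul, eml_mul_inv (loopHolRS_mul_loopHolSR hSR hRS c) hsmall]

variable {G : Type*} [GaugeGroup G]

/-- [folklore] **REAL TIE OF THE INVERSE-SIDE CORRECTION FACTOR**: for a small-loop average `ℰ` with `ℰ.δ ≤ 1∕3` whose operation reads
`eml` after `ι` on small families (`hE`, displayed), `ι` realising `dist1` (`hdist`), and `U` small at `c`: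
`corrSR (ι∘U) (ι∘U⁻¹) c = ι (corr ℰ U c)⁻¹` (`eml_inv_mul` + W-24b's `corrRS_hom_eq_of_small`). -/
theorem corrSR_hom_eq_of_small (ℰ : LoopAverage G) (hδ : ℰ.δ ≤ 1 / 3) (ι : G →* 𝔸) (hdist : ∀ g : G, ‖ι g - 1‖ = dist1 g)
    (hE : ∀ {m : ℕ} (W : Fin (m + 1) → G), (∀ i, dist1 (W i) < ℰ.δ) → ι (ℰ.E W) = eml fun i => ι (W i))
    {U : GaugeField P j G} {c : PBond P (j + 1)} (hU : Small ℰ U c) :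
    corrSR (fun b => ι (U b)) (fun b => ι (U b)⁻¹) c = ι (corr ℰ U c)⁻¹ := by
  have hX : ∀ i, ‖loopHolRS (fun b => ι (U b)) (fun b => ι (U b)⁻¹) c i - 1‖ ≤ 1 / 3 := fun i => by
    rw [loopHolRS_hom_eq, hdist]; exact ((hU i).trans_le hδ).le
  have hpair : ∀ i, loopHolRS (fun b => ι (U b)) (fun b => ι (U b)⁻¹) c i * loopHolSR (fun b => ι (U b)) (fun b => ι (U b)⁻¹) c i = 1 :=
    fun i => by rw [loopHolRS_hom_eq, loopHolSR_hom_eq, ← map_mul, mul_inv_cancel, map_one]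
  have h1 : corrSR (fun b => ι (U b)) (fun b => ι (U b)⁻¹) c * ι (corr ℰ U c) = 1 := by
    rw [← corrRS_hom_eq_of_small ℰ ι hE hU, corrSR, corrRS]; exact eml_inv_mul hpair hX
  have h2 : ι (corr ℰ U c) * ι (corr ℰ U c)⁻¹ = 1 := by rw [← map_mul, mul_inv_cancel, map_one]
  exact left_inv_eq_right_inv h1 h2

/-- [folklore] **REAL TIE OF THE INVERSE SIDE OF THE STEP**: under the same hypotheses
`avgSR (ι∘U) (ι∘U⁻¹) c = ι ((blockAvg ℰ).avg U c)⁻¹` (`(corr · axial)⁻¹ = axial⁻¹ · corr⁻¹`). -/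
theorem avgSR_hom_eq_of_small (ℰ : LoopAverage G) (hδ : ℰ.δ ≤ 1 / 3) (ι : G →* 𝔸) (hdist : ∀ g : G, ‖ι g - 1‖ = dist1 g)
    (hE : ∀ {m : ℕ} (W : Fin (m + 1) → G), (∀ i, dist1 (W i) < ℰ.δ) → ι (ℰ.E W) = eml fun i => ι (W i))
    {U : GaugeField P j G} {c : PBond P (j + 1)} (hU : Small ℰ U c) :
    avgSR (fun b => ι (U b)) (fun b => ι (U b)⁻¹) c = ι ((blockAvg ℰ).avg U c)⁻¹ := by
  rw [BlockAveraging.blockAvg_avg, avgFun, mul_inv_rev, map_mul, avgSR, corrSR_hom_eq_of_small ℰ hδ ι hdist hE hU, axialSR_hom_eq]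

variable {E : Type*} [NormedAddCommGroup E] [NormedSpace ℂ E]

/-- [folklore] **THE INVERSE SIDE IS HOLOMORPHIC** along an analytic two-sided family at every parameter whose REVERSED loop variables
are 1-small (`analyticAt_eml` ∘ `analyticAt_holRS`). -/
theorem analyticAt_avgSR {R S : E → PBond P j → 𝔸} {x : E} (hR : ∀ b, AnalyticAt ℂ (fun y => R y b) x)
    (hS : ∀ b, AnalyticAt ℂ (fun y => S y b) x) (c : PBond P (j + 1)) (hsmall : ∀ i, ‖loopHolSR (R x) (S x) c i - 1‖ < 1) :
    AnalyticAt ℂ (fun y => avgSR (R y) (S y) c) x := by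
  have hW : AnalyticAt ℂ (fun y => fun i : Idx P => loopHolSR (R y) (S y) c i) x :=
    analyticAt_pi_iff.2 fun i => analyticAt_holRS hR hS _
  exact (analyticAt_holRS hR hS _).mul ((analyticAt_eml hsmall).comp_of_eq hW rfl)

end Step

end Summit.QuantumFields.BalabanUV.T4Continuum.SubstrateComplexBlockAvgInv

end
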